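import Mathlib
import Summits.QuantumFields.YangMills.Theorems.TransportFieldFanoVacuumLinkPlaquette
import Summits.QuantumFields.YangMills.Theorems.LuscherReductionTwistedTraceScalingLatticeHS
import HarnessLib

/-!
# Explicit budget of the vacuum energy densities, `−log c_L ≤ 129·L⁴`, and the REDUCTION of stub `stub_dWeightedPlaquetteMean` of
# ⟨stmt-QuantumFields-23362⟩ to a TORELON-MEAN FLOOR (route `TransportFieldFano`, LINE g17-A; helper lane)

Sequel to `…VacuumMagneticEnergy` / `…VacuumElectricEnergy` / `…VacuumLinkPlaquette`.  The β-free constant of those files is the tree's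
`uniformFloorConst L = e^{−8|P|}·winConst(1/(14L))^{|E|}/(8·(5⁸)^{offCount L})`; here it is made explicit in `L`:
* §1 `offCount_le_card_edge`, ★ `neg_log_uniformFloorConst_le` — `−log uniformFloorConst L ≤ 8|P| + (32 + 3 log L)|E|`
  (`winConst a = e^{−1/2}(16/(3π²√π))(a²/2)^{3/2}`, `π < 4`, `log 2 < 0.6932`); ★ `neg_log_uniformFloorConst_le_pow` — `≤ 129·L⁴`
  (`|E| = |P| = 3L³`, `log L ≤ L`);
* §2 explicit corollaries (`β ≥ 1`, every `L`, every `l2`-normalised physical eigenfunction `Ω` at `λ₀`):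
  ★ `vacuum_magnetic_energy_le_pow` — `∫ S Ω² ≤ 129 L⁴/β`;
  ★ `vacuum_link_plaquette_le_pow` — `∫∫ ΩK_βΩ·(4 − 2Re tr UₑVₑ⁻¹) ≤ 588·L⁴·λ₀/β`;
* §3 ★★ `dWeightedPlaquetteMean_of_torelonMeanFloor` — **the registered stub text `DWeightedPlaquetteMeanP` of the birth skeleton of
  ⟨23362⟩ (verbatim) FOLLOWS from a torelon-mean floor** `E_Ω[F] = l2 (FΩ) Ω ≥ c·L^{−k₀}` eventually in `β` (`F` = the site-averaged torelon
  deviation `4 − (Re tr P₀)²` of the stub): the weight `d_x(U) + d_x(V) ∈ [0,8]` is dropped after the Perron–Frobenius reduction to a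
  non-negative eigenfunction, §2 bounds the bare link plaquette by `4704·L⁴·λ₀/β`, and `β^{−1} ≤ β^{ε−1}`; constants `k = k₀ + 4`, `C = 4704/c`.
  So what the (L–XL) stub asks BEYOND kinematics is exactly a zero-mode FLOOR on the one-point function `E_Ω[F]` — the same wall as
  `CoherentToronFloor` ⟨23352⟩, in its mildest (unsigned, polynomial) form.

HONEST FRAMING: fixed-lattice helper estimates and a conditional reduction (`--supports 23362`); the stub itself, the crux, K2a and every rung /
summit statement remain OPEN; nothing here is about infinite volume, the continuum or the Yang–Mills mass gap.  No `sorry`, no new definition.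
References: [cite: ReedSimonIV1978, Thm. XIII.43]; [cite: Luscher1983, §2–3]; [cite: MontvayMunster1994, §3.2.3 (3.97) p.121].
-/

set_option autoImplicit false

noncomputable section

open MeasureTheory Filter Topology Real
open Literature.MathematicalPhysics.QuantumFieldTheory (GaugeConfig Site Edge Plaquette gaugeTransform wilsonAction)
open Literature.MathematicalPhysics.QuantumLattice (fundamentalRep_apply secondCountableTopology_su2)

namespace Summit.QuantumFields.YangMills.Theorems.TransportFieldFano

open Summit.QuantumFields.YangMills.Theorems.FemtoTransferGap
open Summit.QuantumFields.YangMills.Theorems.AdjointLoopFano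

variable {L : ℕ} [NeZero L]

/-! ## §1 The β-free floor constant is `exp(−O(L³ log L))` -/

/-- There are at most `|E|` non-tree links. [folklore] -/
theorem offCount_le_card_edge : offCount L ≤ Fintype.card (Edge 3 L) := by
  unfold offCount
  exact (Finset.card_filter_le _ _).trans (Finset.card_univ (α := Edge 3 L)).le

omit [NeZero L] in
/-- `−log winConst(1/(14L)) ≤ 12 + 3 log L` for `L ≥ 1` (`winConst a = e^{−1/2}·(16/(3π²√π))·(a²/2)^{3/2}`, `3π²√π/16 ≤ 6 ≤ 8`,
`392 ≤ 512`, `log 2 < 0.6932`). [folklore] -/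
theorem neg_log_winConst_le {L : ℕ} (hL : 1 ≤ L) :
    -Real.log (winConst (1 / (14 * (L : ℝ)))) ≤ 12 + 3 * Real.log L := by
  have hL0 : (0 : ℝ) < L := by exact_mod_cast hL
  have hπ0 : 0 < π := Real.pi_pos
  have hπ4 := Real.pi_lt_four
  have hl2 := Real.log_two_lt_d9
  have hsπ : Real.sqrt π ≤ 2 := by
    rw [show (2 : ℝ) = Real.sqrt (2 ^ 2) by rw [Real.sqrt_sq (by norm_num)]]
    exact Real.sqrt_le_sqrt (by nlinarith)
  have hsπ0 : 0 < Real.sqrt π := Real.sqrt_pos.2 hπ0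
  set a : ℝ := 1 / (14 * (L : ℝ)) with ha
  have ha0 : 0 < a := by positivity
  have hq : a ^ 2 / 2 = (392 * (L : ℝ) ^ 2)⁻¹ := by rw [ha]; field_simp; ring
  have hq0 : 0 < a ^ 2 / 2 := by positivity
  unfold winConst
  rw [Real.log_mul (by positivity) (by positivity), Real.log_mul (by positivity) (by positivity), Real.log_exp,
    Real.log_mul hq0.ne' (Real.sqrt_pos.2 hq0).ne', Real.log_sqrt hq0.le, hq, Real.log_inv,
    Real.log_mul (by norm_num) (by positivity), Real.log_pow]
  -- `log(16/(3π²√π)) ≥ −log 8 = −3 log 2`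
  have h1 : -(3 * Real.log 2) ≤ Real.log (16 / (3 * π ^ 2 * Real.sqrt π)) := by
    have hden : 3 * π ^ 2 * Real.sqrt π ≤ 3 * 16 * 2 := by
      have : π ^ 2 ≤ 16 := by nlinarith
      calc 3 * π ^ 2 * Real.sqrt π ≤ 3 * 16 * Real.sqrt π := by gcongr
        _ ≤ 3 * 16 * 2 := by gcongr
    have h : ((2 : ℝ) ^ 3)⁻¹ ≤ 16 / (3 * π ^ 2 * Real.sqrt π) := by
      rw [le_div_iff₀ (by positivity)]; nlinarith
    calc -(3 * Real.log 2) = Real.log ((2 : ℝ) ^ 3)⁻¹ := by rw [Real.log_inv, Real.log_pow]; norm_num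
      _ ≤ Real.log (16 / (3 * π ^ 2 * Real.sqrt π)) := Real.log_le_log (by positivity) h
  -- `log 392 ≤ 9 log 2`
  have h2 : Real.log 392 ≤ 9 * Real.log 2 := by
    calc Real.log 392 ≤ Real.log ((2 : ℝ) ^ 9) := Real.log_le_log (by norm_num) (by norm_num)
      _ = 9 * Real.log 2 := by rw [Real.log_pow]; norm_num
  have hlogL : 0 ≤ Real.log L := Real.log_nonneg (by exact_mod_cast hL)
  nlinarith

/-- ★ **`−log uniformFloorConst L ≤ 8|P| + (32 + 3 log L)|E|`** (every `L ≥ 1`): the β-free floor constant of ✓`levelValue_zero_ge_uniform`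
is `exp(−O(L³ log L))`. [folklore] -/
theorem neg_log_uniformFloorConst_le :
    -Real.log (uniformFloorConst L) ≤
      8 * Fintype.card (Plaquette 3 L) + (32 + 3 * Real.log L) * Fintype.card (Edge 3 L) := by
  have hL : 1 ≤ L := Nat.one_le_iff_ne_zero.mpr (NeZero.ne L)
  have hL0 : (0 : ℝ) < L := by exact_mod_cast hL
  set E : ℕ := Fintype.card (Edge 3 L) with hE
  set P : ℕ := Fintype.card (Plaquette 3 L) with hP
  have hE1 : (1 : ℝ) ≤ E := by
    have : 0 < Fintype.card (Edge 3 L) := Fintype.card_pos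
    exact_mod_cast this
  have hw : 0 < winConst (1 / (14 * (L : ℝ))) := winConst_pos (by positivity)
  have hoff : (offCount L : ℝ) ≤ E := by exact_mod_cast offCount_le_card_edge (L := L)
  have hl2 := Real.log_two_lt_d9
  have hl5 : Real.log ((5 : ℝ) ^ 8) ≤ 24 * Real.log 2 := by
    calc Real.log ((5 : ℝ) ^ 8) ≤ Real.log ((2 : ℝ) ^ 24) := Real.log_le_log (by norm_num) (by norm_num)
      _ = 24 * Real.log 2 := by rw [Real.log_pow]; norm_num
  have hl5' : 0 ≤ Real.log ((5 : ℝ) ^ 8) := Real.log_nonneg (by norm_num)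
  have hl8 : Real.log 8 = 3 * Real.log 2 := by
    rw [show (8 : ℝ) = 2 ^ 3 by norm_num, Real.log_pow]; norm_num
  have hwin := neg_log_winConst_le hL
  have hlogL : 0 ≤ Real.log L := Real.log_nonneg (by exact_mod_cast hL)
  unfold uniformFloorConst
  rw [← hE, ← hP, Real.log_div (by positivity) (by positivity), Real.log_mul (by positivity) (by positivity), Real.log_exp,
    Real.log_pow, Real.log_mul (by norm_num) (by positivity), Real.log_pow, hl8]
  have hoff' : (offCount L : ℝ) * Real.log ((5 : ℝ) ^ 8) ≤ E * (24 * Real.log 2) :=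
    mul_le_mul hoff hl5 hl5' (by positivity)
  have hEw : (E : ℝ) * (-Real.log (winConst (1 / (14 * (L : ℝ))))) ≤ E * (12 + 3 * Real.log L) :=
    mul_le_mul_of_nonneg_left hwin (by positivity)
  have hE3 : 3 * Real.log 2 ≤ 3 * (E : ℝ) := by linarith
  have h24 : (E : ℝ) * (24 * Real.log 2) ≤ E * 17 := mul_le_mul_of_nonneg_left (by linarith) (by positivity)
  have hEw' : -((E : ℝ) * Real.log (winConst (1 / (14 * (L : ℝ))))) ≤ E * 12 + 3 * Real.log L * E := by linarith
  have key : -(-(8 * (P : ℝ)) + E * Real.log (winConst (1 / (14 * (L : ℝ)))) - (3 * Real.log 2 + (offCount L : ℝ) * Real.log ((5 : ℝ) ^ 8)))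
      ≤ 8 * P + (32 + 3 * Real.log L) * E := by
    have e1 : -(-(8 * (P : ℝ)) + E * Real.log (winConst (1 / (14 * (L : ℝ)))) - (3 * Real.log 2 + (offCount L : ℝ) * Real.log ((5 : ℝ) ^ 8)))
        = 8 * P + (-((E : ℝ) * Real.log (winConst (1 / (14 * (L : ℝ)))))) + 3 * Real.log 2 + (offCount L : ℝ) * Real.log ((5 : ℝ) ^ 8) := by
      ring
    have e2 : (8 : ℝ) * P + (32 + 3 * Real.log L) * E = 8 * P + (E * 12 + 3 * Real.log L * E) + 3 * E + E * 17 := by ring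
    rw [e1, e2]
    exact add_le_add (add_le_add (add_le_add le_rfl hEw') hE3) (hoff'.trans h24)
  exact key

/-- ★ **`−log uniformFloorConst L ≤ 129·L⁴`** (`|E| = |P| = 3L³`, `log L ≤ L`). [folklore] -/
theorem neg_log_uniformFloorConst_le_pow : -Real.log (uniformFloorConst L) ≤ 129 * (L : ℝ) ^ 4 := by
  have hL : 1 ≤ L := Nat.one_le_iff_ne_zero.mpr (NeZero.ne L)
  have hL1 : (1 : ℝ) ≤ L := by exact_mod_cast hL
  have h := neg_log_uniformFloorConst_le (L := L)
  have hE : (Fintype.card (Edge 3 L) : ℝ) = 3 * (L : ℝ) ^ 3 := by exact_mod_cast card_edge_three L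
  have hP : (Fintype.card (Plaquette 3 L) : ℝ) = 3 * (L : ℝ) ^ 3 := by exact_mod_cast card_plaquette_three L
  rw [hE, hP] at h
  have hlog : Real.log L ≤ L := (Real.log_le_sub_one_of_pos (by positivity)).trans (by linarith)
  have hlog0 : 0 ≤ Real.log L := Real.log_nonneg hL1
  have hL3 : (L : ℝ) ^ 3 ≤ (L : ℝ) ^ 4 := pow_le_pow_right₀ hL1 (by norm_num)
  nlinarith [pow_pos (show (0:ℝ) < L by positivity) 3]

/-! ## §2 Explicit corollaries -/

/-- ★ **Vacuum magnetic energy, explicit**: `∫ S Ω² ≤ 129·L⁴/β` (`β ≥ 1`; every `l2`-normalised physical eigenfunction at `λ₀`).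
[cite: Luscher1983, §2–3] -/
theorem vacuum_magnetic_energy_le_pow {β : ℝ} (hβ : 1 ≤ β) {Ω : GaugeConfig 3 L SU2 → ℝ} (hΩ : IsPhys Ω)
    (hn : l2 Ω Ω = 1) (heig : transferApply β Ω = topValue su2Rep L β • Ω) :
    ∫ U, wilsonAction su2Rep U * Ω U ^ 2 ∂configMeasure SU2 L ≤ 129 * (L : ℝ) ^ 4 / β :=
  (vacuum_magnetic_energy_le hβ hΩ hn heig).trans
    (div_le_div_of_nonneg_right neg_log_uniformFloorConst_le_pow (by linarith))

/-- ★ **One temporal plaquette, explicit**: `∫∫ ΩK_βΩ·(4 − 2Re tr UₑVₑ⁻¹) ≤ 588·L⁴·λ₀/β` (`β ≥ 1`; `6|E| = 18L³ ≤ 18L⁴`, `4·(18+129) = 588`).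
[cite: Luscher1983, §2] -/
theorem vacuum_link_plaquette_le_pow {β : ℝ} (hβ : 1 ≤ β) {Ω : GaugeConfig 3 L SU2 → ℝ} (hΩ : IsPhys Ω)
    (hn : l2 Ω Ω = 1) (heig : transferApply β Ω = topValue su2Rep L β • Ω) (e : Edge 3 L) :
    ∫ p, Ω p.1 * transferKernel su2Rep β p.1 p.2 * Ω p.2 *
        (4 - 2 * ((((p.1 e * (p.2 e)⁻¹ : SU2) : Matrix (Fin 2) (Fin 2) ℂ)).trace).re)
        ∂(configMeasure SU2 L).prod (configMeasure SU2 L) ≤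
      588 * (L : ℝ) ^ 4 * topValue su2Rep L β / β := by
  have hL : 1 ≤ L := Nat.one_le_iff_ne_zero.mpr (NeZero.ne L)
  have hL1 : (1 : ℝ) ≤ L := by exact_mod_cast hL
  have hβ0 : 0 < β := by linarith
  have hT := topValue_su2Rep_pos L β
  have h := vacuum_link_plaquette_le hβ hΩ hn heig e
  have hE : (Fintype.card (Edge 3 L) : ℝ) = 3 * (L : ℝ) ^ 3 := by exact_mod_cast card_edge_three L
  have hu := neg_log_uniformFloorConst_le_pow (L := L)
  have hL3 : (L : ℝ) ^ 3 ≤ (L : ℝ) ^ 4 := pow_le_pow_right₀ hL1 (by norm_num)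
  have hbud : 6 * (Fintype.card (Edge 3 L) : ℝ) - Real.log (uniformFloorConst L) ≤ 147 * (L : ℝ) ^ 4 := by
    rw [hE]; linarith
  calc _ ≤ (4 / β) * topValue su2Rep L β * (6 * Fintype.card (Edge 3 L) - Real.log (uniformFloorConst L)) := h
    _ ≤ (4 / β) * topValue su2Rep L β * (147 * (L : ℝ) ^ 4) := mul_le_mul_of_nonneg_left hbud (by positivity)
    _ = 588 * (L : ℝ) ^ 4 * topValue su2Rep L β / β := by field_simp; ring

/-! ## §3 The registered stub of ⟨23362⟩ follows from a torelon-mean floor -/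

/-- ★★ **`stub_dWeightedPlaquetteMean` ⟸ TORELON-MEAN FLOOR.**  If the vacuum mean of the site-averaged torelon deviation
`F = flowLift 0 (4 − (Re tr P₀)²)` obeys `c·L^{−k₀} ≤ l2 (FΩ) Ω` for all `β ≥ β₁`, every `L` and every `l2`-normalised physical eigenfunction
`Ω` at `λ₀` (`c > 0`), then the registered stub text `DWeightedPlaquetteMeanP` of the birth skeleton of ⟨stmt-QuantumFields-23362⟩ holds
(verbatim conclusion; `k = k₀ + 4`, `C = 4704/c`, `β₀ = max 1 β₁`): the weight `d_x(U)+d_x(V) ∈ [0,8]` is dropped on the non-negative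
Perron–Frobenius representative and `vacuum_link_plaquette_le_pow` bounds the bare link plaquette by `588 L⁴λ₀/β ≤ 588 β^{ε−1}L⁴λ₀`.
[cite: ReedSimonIV1978, Thm. XIII.43] [cite: Luscher1983, §2–3] -/
theorem dWeightedPlaquetteMean_of_torelonMeanFloor
    (hfloor : ∃ c k₀ : ℝ, 0 < c ∧ ∃ β₁ : ℝ, ∀ β : ℝ, β₁ ≤ β → ∀ (L : ℕ) [NeZero L],
      ∀ Ω : Literature.MathematicalPhysics.QuantumFieldTheory.GaugeConfig 3 L SU2 → ℝ, IsPhys Ω → l2 Ω Ω = 1 →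
        transferApply β Ω = topValue su2Rep L β • Ω →
          c * (L : ℝ) ^ (-k₀) ≤ l2 (fun U => flowLift 0 (fun u : Literature.MathematicalPhysics.QuantumFieldTheory.GaugeConfig 3 1 SU2 =>
            4 - ((su2Rep (u ((0 : Literature.MathematicalPhysics.QuantumFieldTheory.Site 3 1), (0 : Fin 3)))).trace.re) ^ 2) U * Ω U) Ω) :
    ∃ k : ℝ, ∀ ε : ℝ, 0 < ε → ∃ C β₀ : ℝ, ∀ β : ℝ, β₀ ≤ β → ∀ (L : ℕ) [NeZero L], ∀ Ω : Literature.MathematicalPhysics.QuantumFieldTheory.GaugeConfig 3 L SU2 → ℝ, IsPhys Ω → l2 Ω Ω = 1 → transferApply β Ω = topValue su2Rep L β • Ω → let F : Literature.MathematicalPhysics.QuantumFieldTheory.GaugeConfig 3 L SU2 → ℝ := flowLift 0 (fun u : Literature.MathematicalPhysics.QuantumFieldTheory.GaugeConfig 3 1 SU2 => 4 - ((su2Rep (u ((0 : Literature.MathematicalPhysics.QuantumFieldTheory.Site 3 1), (0 : Fin 3)))).trace.re) ^ 2); ∀ x : Literature.MathematicalPhysics.QuantumFieldTheory.Site 3 L,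 ∀ j : ℕ, j < L → ∫ p, Ω p.1 * transferKernel su2Rep β p.1 p.2 * Ω p.2 * ((flowLiftAt x 0 (fun u : Literature.MathematicalPhysics.QuantumFieldTheory.GaugeConfig 3 1 SU2 => 4 - ((su2Rep (u ((0 : Literature.MathematicalPhysics.QuantumFieldTheory.Site 3 1), (0 : Fin 3)))).trace.re) ^ 2) p.1 + flowLiftAt x 0 (fun u : Literature.MathematicalPhysics.QuantumFieldTheory.GaugeConfig 3 1 SU2 => 4 - ((su2Rep (u ((0 : Literature.MathematicalPhysics.QuantumFieldTheory.Site 3 1), (0 : Fin 3)))).trace.re) ^ 2) p.2) * (4 - 2 * (((p.1 ((fun z : Literature.MathematicalPhysics.QuantumFieldTheory.Site 3 L => z.shift 0)^[j] x, 0) * (p.2 ((fun z : Literature.MathematicalPhysics.QuantumFieldTheory.Site 3 L => z.shift 0)^[j] x, 0))⁻¹ : SU2) : Matrix (Fin 2) (Fin 2) ℂ).trace.re))) ∂(configMeasure SU2 L).prod (configMeasure SU2 L) ≤ C * β ^ (ε - 1) * (L : ℝ) ^ k * topValue su2Rep L β * l2 (fun U => F U * Ω U) Ω := by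
  obtain ⟨c, k₀, hc, β₁, hfl⟩ := hfloor
  refine ⟨k₀ + 4, fun ε hε => ⟨4704 / c, max 1 β₁, fun β hβ L _ Ω hΩ hn heig => ?_⟩⟩
  dsimp only
  intro x j _
  haveI : SecondCountableTopology SU2 := secondCountableTopology_su2
  have hβ1 : 1 ≤ β := (le_max_left _ _).trans hβ
  have hββ₁ : β₁ ≤ β := (le_max_right _ _).trans hβ
  have hβ0 : 0 < β := by linarith
  have hL : 1 ≤ L := Nat.one_le_iff_ne_zero.mpr (NeZero.ne L)
  have hL0 : (0 : ℝ) < L := by exact_mod_cast hL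
  have hL1 : (1 : ℝ) ≤ L := by exact_mod_cast hL
  have hT := topValue_su2Rep_pos L β
  -- abbreviations
  set f : GaugeConfig 3 1 SU2 → ℝ := fun u => 4 - ((su2Rep (u ((0 : Site 3 1), (0 : Fin 3)))).trace.re) ^ 2 with hf_def
  set e : Edge 3 L := ((fun z : Site 3 L => z.shift 0)^[j] x, 0) with he_def
  set Pl : GaugeConfig 3 L SU2 × GaugeConfig 3 L SU2 → ℝ :=
    fun p => 4 - 2 * ((((p.1 e * (p.2 e)⁻¹ : SU2) : Matrix (Fin 2) (Fin 2) ℂ)).trace).re with hPl_def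
  have hf0 : ∀ u, 0 ≤ f u := fun u => by
    rw [hf_def]; dsimp only
    have h1 := re_trace_le_two (u ((0 : Site 3 1), (0 : Fin 3)))
    have h2 := neg_two_le_re_trace (u ((0 : Site 3 1), (0 : Fin 3)))
    rw [fundamentalRep_apply]; nlinarith
  have hf4 : ∀ u, f u ≤ 4 := fun u => by
    rw [hf_def]; dsimp only; nlinarith [sq_nonneg ((su2Rep (u ((0 : Site 3 1), (0 : Fin 3)))).trace.re)]
  have hd0 : ∀ (y : Site 3 L) (U : GaugeConfig 3 L SU2), 0 ≤ flowLiftAt y 0 f U := fun y U => by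
    unfold flowLiftAt; exact hf0 _
  have hd4 : ∀ (y : Site 3 L) (U : GaugeConfig 3 L SU2), flowLiftAt y 0 f U ≤ 4 := fun y U => by
    unfold flowLiftAt; exact hf4 _
  have hPl0 : ∀ p, 0 ≤ Pl p := fun p => by
    rw [hPl_def]; dsimp only; linarith [re_trace_le_two (p.1 e * (p.2 e)⁻¹)]
  have hPl8 : ∀ p, Pl p ≤ 8 := fun p => by
    rw [hPl_def]; dsimp only; linarith [neg_two_le_re_trace (p.1 e * (p.2 e)⁻¹)]
  have hPlm : Measurable Pl := by
    have hc1 : Continuous fun p : GaugeConfig 3 L SU2 × GaugeConfig 3 L SU2 => (p.1 e * (p.2 e)⁻¹ : SU2) :=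
      ((continuous_apply e).comp continuous_fst).mul ((continuous_apply e).comp continuous_snd).inv
    have hc2 : Continuous fun p : GaugeConfig 3 L SU2 × GaugeConfig 3 L SU2 =>
        ((((p.1 e * (p.2 e)⁻¹ : SU2) : Matrix (Fin 2) (Fin 2) ℂ)).trace).re :=
      Complex.continuous_re.comp ((continuous_subtype_val.comp hc1).matrix_trace)
    exact (continuous_const.sub (continuous_const.mul hc2)).measurable
  -- Perron–Frobenius: non-negative representative
  obtain ⟨Ωp, θ, cp, hΩp, hcp, hΩpge, hnp, heigp, -, hθ, hgap⟩ := PhysL2.exists_groundState (L := L) β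
  set c' : ℝ := l2 Ω Ωp with hc'
  have hae : Ω =ᵐ[configMeasure SU2 L] fun U => c' * Ωp U := ae_eq_smul_groundState hΩ hΩp hnp heig heigp hθ hgap
  set Ω'' : GaugeConfig 3 L SU2 → ℝ := fun U => |c'| * Ωp U with hΩ''_def
  have hΩ'' : IsPhys Ω'' := by
    have h := hΩp.smul |c'|
    have e' : (|c'| • Ωp) = Ω'' := by funext U; simp [hΩ''_def]
    rw [← e']; exact h
  have hΩ''nn : ∀ U, 0 ≤ Ω'' U := fun U => mul_nonneg (abs_nonneg c') (hcp.le.trans (hΩpge U))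
  have heig'' : transferApply β Ω'' = topValue su2Rep L β • Ω'' := by
    have e' : Ω'' = |c'| • Ωp := by funext U; simp [hΩ''_def]
    rw [e', transferApply_smul, heigp, smul_smul, smul_smul, mul_comm]
  have hsq : ∀ U, Ω U = c' * Ωp U → ∀ V, Ω V = c' * Ωp V → Ω U * Ω V = Ω'' U * Ω'' V := fun U hU V hV => by
    rw [hU, hV, hΩ''_def]; dsimp only
    have : c' * Ωp U * (c' * Ωp V) = c' * c' * (Ωp U * Ωp V) := by ring
    rw [this, ← sq, ← sq_abs c']; ring
  have hn'' : l2 Ω'' Ω'' = 1 := by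
    rw [← hn]; unfold l2
    refine integral_congr_ae ?_
    filter_upwards [hae] with U hU
    exact (hsq U hU U hU).symm
  have hfst : (fun p : GaugeConfig 3 L SU2 × GaugeConfig 3 L SU2 => Ω p.1) =ᵐ[(configMeasure SU2 L).prod (configMeasure SU2 L)]
      fun p => c' * Ωp p.1 :=
    (Measure.quasiMeasurePreserving_fst (μ := configMeasure SU2 L) (ν := configMeasure SU2 L)).ae_eq hae
  have hsnd : (fun p : GaugeConfig 3 L SU2 × GaugeConfig 3 L SU2 => Ω p.2) =ᵐ[(configMeasure SU2 L).prod (configMeasure SU2 L)]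
      fun p => c' * Ωp p.2 :=
    (Measure.quasiMeasurePreserving_snd (μ := configMeasure SU2 L) (ν := configMeasure SU2 L)).ae_eq hae
  have hRHS : ∀ G : GaugeConfig 3 L SU2 × GaugeConfig 3 L SU2 → ℝ,
      ∫ p, Ω p.1 * transferKernel su2Rep β p.1 p.2 * Ω p.2 * G p ∂(configMeasure SU2 L).prod (configMeasure SU2 L) =
      ∫ p, Ω'' p.1 * transferKernel su2Rep β p.1 p.2 * Ω'' p.2 * G p ∂(configMeasure SU2 L).prod (configMeasure SU2 L) := by
    intro G
    refine integral_congr_ae ?_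
    filter_upwards [hfst, hsnd] with p h1 h2
    have h := hsq p.1 h1 p.2 h2
    calc Ω p.1 * transferKernel su2Rep β p.1 p.2 * Ω p.2 * G p = (Ω p.1 * Ω p.2) * transferKernel su2Rep β p.1 p.2 * G p := by ring
      _ = (Ω'' p.1 * Ω'' p.2) * transferKernel su2Rep β p.1 p.2 * G p := by rw [h]
      _ = Ω'' p.1 * transferKernel su2Rep β p.1 p.2 * Ω'' p.2 * G p := by ring
  -- the weighted link plaquette for `Ω''`: drop the weight (≤ 8)
  set w : GaugeConfig 3 L SU2 × GaugeConfig 3 L SU2 → ℝ := fun p => Ω'' p.1 * transferKernel su2Rep β p.1 p.2 * Ω'' p.2 with hw_def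
  have hw0 : ∀ p, 0 ≤ w p := fun p =>
    mul_nonneg (mul_nonneg (hΩ''nn _) (transferKernel_pos _ _ _ _).le) (hΩ''nn _)
  obtain ⟨CΩ, hCΩ⟩ := hΩ''.bounded
  have hCΩ0 : 0 ≤ CΩ := (abs_nonneg _).trans (hCΩ (fun _ => 1))
  have hwm : Measurable w := ((hΩ''.measurable.comp measurable_fst).mul (measurable_transferKernel_lat β)).mul
    (hΩ''.measurable.comp measurable_snd)
  have hwb : ∀ p, |w p| ≤ CΩ * Real.exp (2 * β) ^ Fintype.card (Edge 3 L) * CΩ := fun p => by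
    rw [hw_def]; dsimp only; rw [abs_mul, abs_mul]
    exact mul_le_mul (mul_le_mul (hCΩ _) (abs_transferKernel_le_lat hβ0.le p) (abs_nonneg _) hCΩ0) (hCΩ _) (abs_nonneg _)
      (by positivity)
  have hgi0 : Integrable (fun p => w p * Pl p) ((configMeasure SU2 L).prod (configMeasure SU2 L)) :=
    integrable_latProd (show Measurable (fun p => w p * Pl p) from hwm.mul hPlm)
      (C := CΩ * Real.exp (2 * β) ^ Fintype.card (Edge 3 L) * CΩ * 8) fun p => by
      rw [abs_mul, abs_of_nonneg (hPl0 p)]; exact mul_le_mul (hwb p) (hPl8 p) (hPl0 p) (by positivity)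
  have hgi : Integrable (fun p => 8 * (w p * Pl p)) ((configMeasure SU2 L).prod (configMeasure SU2 L)) := hgi0.const_mul 8
  have hmono : ∫ p, w p * ((flowLiftAt x 0 f p.1 + flowLiftAt x 0 f p.2) * Pl p) ∂(configMeasure SU2 L).prod (configMeasure SU2 L) ≤
      ∫ p, 8 * (w p * Pl p) ∂(configMeasure SU2 L).prod (configMeasure SU2 L) := by
    refine integral_mono_of_nonneg (ae_of_all _ fun p => ?_) hgi (ae_of_all _ fun p => ?_)
    · exact mul_nonneg (hw0 p) (mul_nonneg (add_nonneg (hd0 _ _) (hd0 _ _)) (hPl0 p))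
    · have h8 : flowLiftAt x 0 f p.1 + flowLiftAt x 0 f p.2 ≤ 8 := by linarith [hd4 x p.1, hd4 x p.2]
      have := mul_le_mul_of_nonneg_right h8 (hPl0 p)
      nlinarith [hw0 p, mul_nonneg (hw0 p) (hPl0 p)]
  have hlink := vacuum_link_plaquette_le_pow hβ1 hΩ'' hn'' heig'' e
  have hlink' : ∫ p, 8 * (w p * Pl p) ∂(configMeasure SU2 L).prod (configMeasure SU2 L) ≤ 8 * (588 * (L : ℝ) ^ 4 * topValue su2Rep L β / β) := by
    rw [integral_const_mul]
    refine mul_le_mul_of_nonneg_left ?_ (by norm_num)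
    have : (fun p => w p * Pl p) = fun p : GaugeConfig 3 L SU2 × GaugeConfig 3 L SU2 => Ω'' p.1 * transferKernel su2Rep β p.1 p.2 * Ω'' p.2 *
        (4 - 2 * ((((p.1 e * (p.2 e)⁻¹ : SU2) : Matrix (Fin 2) (Fin 2) ℂ)).trace).re) := by
      funext p; rw [hw_def, hPl_def]
    rw [this]; exact hlink
  -- the floor and the `β`-powers
  have hflo := hfl β hββ₁ L Ω hΩ hn heig
  have hrpow : β ^ (-(1 : ℝ)) ≤ β ^ (ε - 1) := Real.rpow_le_rpow_of_exponent_le hβ1 (by linarith)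
  have hβinv : β ^ (-(1 : ℝ)) = 1 / β := by rw [Real.rpow_neg hβ0.le, Real.rpow_one]; field_simp
  have hLk : (L : ℝ) ^ (k₀ + 4) * (L : ℝ) ^ (-k₀) = (L : ℝ) ^ 4 := by
    rw [← Real.rpow_add hL0, show k₀ + 4 + -k₀ = ((4 : ℕ) : ℝ) by push_cast; ring, Real.rpow_natCast]
  have hLk0 : 0 < (L : ℝ) ^ (k₀ + 4) := Real.rpow_pos_of_pos hL0 _
  -- assemble: LHS(Ω) = LHS(Ω'') ≤ 8·588 L⁴ λ₀/β = 4704 β^{-1} L⁴ λ₀ ≤ (4704/c) β^{ε−1} L^{k₀+4} λ₀ · (c L^{−k₀}) ≤ RHS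
  have hstep1 : ∫ p, Ω p.1 * transferKernel su2Rep β p.1 p.2 * Ω p.2 * ((flowLiftAt x 0 f p.1 + flowLiftAt x 0 f p.2) * Pl p)
      ∂(configMeasure SU2 L).prod (configMeasure SU2 L) ≤ 4704 * (L : ℝ) ^ 4 * topValue su2Rep L β / β := by
    rw [hRHS]
    have : (fun p => Ω'' p.1 * transferKernel su2Rep β p.1 p.2 * Ω'' p.2 * ((flowLiftAt x 0 f p.1 + flowLiftAt x 0 f p.2) * Pl p)) =
        fun p => w p * ((flowLiftAt x 0 f p.1 + flowLiftAt x 0 f p.2) * Pl p) := by funext p; rw [hw_def]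
    rw [this]
    calc _ ≤ ∫ p, 8 * (w p * Pl p) ∂(configMeasure SU2 L).prod (configMeasure SU2 L) := hmono
      _ ≤ 8 * (588 * (L : ℝ) ^ 4 * topValue su2Rep L β / β) := hlink'
      _ = 4704 * (L : ℝ) ^ 4 * topValue su2Rep L β / β := by ring
  have hstep2 : 4704 * (L : ℝ) ^ 4 * topValue su2Rep L β / β ≤
      4704 / c * β ^ (ε - 1) * (L : ℝ) ^ (k₀ + 4) * topValue su2Rep L β * (c * (L : ℝ) ^ (-k₀)) := by
    have e1 : 4704 / c * β ^ (ε - 1) * (L : ℝ) ^ (k₀ + 4) * topValue su2Rep L β * (c * (L : ℝ) ^ (-k₀)) =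
        4704 * β ^ (ε - 1) * ((L : ℝ) ^ (k₀ + 4) * (L : ℝ) ^ (-k₀)) * topValue su2Rep L β := by
      field_simp
    rw [e1, hLk]
    have e2 : 4704 * (L : ℝ) ^ 4 * topValue su2Rep L β / β = 4704 * β ^ (-(1 : ℝ)) * (L : ℝ) ^ 4 * topValue su2Rep L β := by
      rw [hβinv]; field_simp
    rw [e2]
    have h0 : 0 ≤ 4704 * (L : ℝ) ^ 4 * topValue su2Rep L β := by positivity
    nlinarith [mul_le_mul_of_nonneg_left hrpow h0]
  have hstep3 : 4704 / c * β ^ (ε - 1) * (L : ℝ) ^ (k₀ + 4) * topValue su2Rep L β * (c * (L : ℝ) ^ (-k₀)) ≤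
      4704 / c * β ^ (ε - 1) * (L : ℝ) ^ (k₀ + 4) * topValue su2Rep L β * l2 (fun U => flowLift 0 f U * Ω U) Ω :=
    mul_le_mul_of_nonneg_left hflo (by positivity)
  exact hstep1.trans (hstep2.trans hstep3)

end Summit.QuantumFields.YangMills.Theorems.TransportFieldFano

end
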